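import Mathlib
import Summits.ValiantsHypothesis.ValiantsHypothesis.Theorems.RigidityForcesSymmetryRankRigidMinimalReprLaplaceFiveSymmetricPieces
import Summits.ValiantsHypothesis.ValiantsHypothesis.Theorems.RigidityForcesSymmetryRankRigidMinimalReprLaplaceFiveTriangleSeparation

/-!
# ValiantsHypothesis / RigidityForcesSymmetry — crux `LaplaceOptimalFive` (stmt-ValiantsHypothesis-24813), crux idea
`young-shadow` (K1): NO CHEAP SIDE-SYMMETRIC DECOMPOSITION ON THE TRIANGLE `{0,1}, {0,2}, {1,2}`.

Prop A of the card on the triangle support: a SIDE-SYMMETRIC split decomposition of `P₅` all of whose terms sit on the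
three pair splits `{0,1}, {0,2}, {1,2}` has at least ten terms (weight `≥ 120`).  In particular the nine-term profile
`3·01 + 3·02 + 3·12` (an LM tail of weight 108, open for general factors) has no side-symmetric solution — its border
tail, if real, lives in the asymmetric sector.  Assembly of `LaplaceFiveTriangleSeparation.threeSplit_separation_triangle`
(the shadows separate) and `LaplaceFiveSymmetricPieces.symmetricPieces_needTen` (catalecticant step); vocabulary of the
sketch (`IsSplitDecomposition`, `SideSymmetric`, `SlotInvariantOn`) UNFOLDED.

Honest framing.  One rigid support of K1 `SideSymLaplaceOptimalFive`; K1, `LaplaceOptimalFive` (OPEN · CONTESTED 72/120),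
`RankRigidMinimalRepr`, `VP ≠ VNP` are NOT proved.  No definitions, no `sorry`; Mathlib only.
-/

set_option linter.dupNamespace false

namespace Summit.ValiantsHypothesis.ValiantsHypothesis.Theorems.RigidityForcesSymmetryRankRigidMinimalRepr

namespace LaplaceFiveTriangleSeparation

open Finset

/-- The Young shadow of a side-symmetric cylindrical family on the pair split `A` is symmetric within `A`. [folklore] -/
theorem shadow_inv_left {N : ℕ} (T : Finset (Fin N)) (S : Fin N → Finset (Fin 5)) (u w : Fin N → (Fin 5 → Fin 5) → ℂ)
    (hw : ∀ t, ∀ v v' : Fin 5 → Fin 5, (∀ i, i ∉ S t → v i = v' i) → w t v = w t v')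
    (hsym : ∀ t ∈ T, (∀ τ : Equiv.Perm (Fin 5), (∀ i, i ∉ S t → τ i = i) → ∀ v : Fin 5 → Fin 5, u t (v ∘ ⇑τ) = u t v) ∧
      (∀ τ : Equiv.Perm (Fin 5), (∀ i, i ∉ (S t)ᶜ → τ i = i) → ∀ v : Fin 5 → Fin 5, w t (v ∘ ⇑τ) = w t v))
    (A : Finset (Fin 5)) (τ : Equiv.Perm (Fin 5)) (hτ : ∀ i, i ∉ A → τ i = i) (v : Fin 5 → Fin 5) :
    ∑ t ∈ T.filter (fun t => S t = A), u t (v ∘ ⇑τ) * w t (v ∘ ⇑τ)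
      = ∑ t ∈ T.filter (fun t => S t = A), u t v * w t v := by
  refine Finset.sum_congr rfl fun t ht => ?_
  obtain ⟨htT, hS⟩ := Finset.mem_filter.mp ht
  rw [(hsym t htT).1 τ (fun i hi => hτ i (hS ▸ hi)) v,
    hw t (v ∘ ⇑τ) v (fun i hi => by simp only [Function.comp, hτ i (hS ▸ hi)])]

/-- The Young shadow on the pair split `A` is symmetric within `Aᶜ`. [folklore] -/
theorem shadow_inv_right {N : ℕ} (T : Finset (Fin N)) (S : Fin N → Finset (Fin 5)) (u w : Fin N → (Fin 5 → Fin 5) → ℂ)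
    (hu : ∀ t, ∀ v v' : Fin 5 → Fin 5, (∀ i ∈ S t, v i = v' i) → u t v = u t v')
    (hsym : ∀ t ∈ T, (∀ τ : Equiv.Perm (Fin 5), (∀ i, i ∉ S t → τ i = i) → ∀ v : Fin 5 → Fin 5, u t (v ∘ ⇑τ) = u t v) ∧
      (∀ τ : Equiv.Perm (Fin 5), (∀ i, i ∉ (S t)ᶜ → τ i = i) → ∀ v : Fin 5 → Fin 5, w t (v ∘ ⇑τ) = w t v))
    (A : Finset (Fin 5)) (τ : Equiv.Perm (Fin 5)) (hτ : ∀ i, i ∉ Aᶜ → τ i = i) (v : Fin 5 → Fin 5) :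
    ∑ t ∈ T.filter (fun t => S t = A), u t (v ∘ ⇑τ) * w t (v ∘ ⇑τ)
      = ∑ t ∈ T.filter (fun t => S t = A), u t v * w t v := by
  refine Finset.sum_congr rfl fun t ht => ?_
  obtain ⟨htT, hS⟩ := Finset.mem_filter.mp ht
  rw [(hsym t htT).2 τ (fun i hi => hτ i (hS ▸ hi)) v,
    hu t (v ∘ ⇑τ) v (fun i hi => by
      simp only [Function.comp]
      rw [hτ i (fun h => (Finset.mem_compl.mp (hS ▸ h)) hi)])]

/-- **No cheap side-symmetric decomposition on the triangle**: a side-symmetric split decomposition of `P₅` by terms on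
the pair splits `{0,1}, {0,2}, {1,2}` has at least ten terms (weight `≥ 120`). [folklore] -/
theorem sideSym_triangle_ten_le (N : ℕ) (T : Finset (Fin N)) (S : Fin N → Finset (Fin 5))
    (u w : Fin N → (Fin 5 → Fin 5) → ℂ)
    (hdec : (∀ t, ∀ v v' : Fin 5 → Fin 5, (∀ i ∈ S t, v i = v' i) → u t v = u t v') ∧
      (∀ t, ∀ v v' : Fin 5 → Fin 5, (∀ i, i ∉ S t → v i = v' i) → w t v = w t v') ∧
      (∀ v : Fin 5 → Fin 5, (∑ t ∈ T, u t v * w t v) = if Function.Injective v then 1 else 0))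
    (hsym : ∀ t ∈ T, (∀ τ : Equiv.Perm (Fin 5), (∀ i, i ∉ S t → τ i = i) → ∀ v : Fin 5 → Fin 5, u t (v ∘ ⇑τ) = u t v) ∧
      (∀ τ : Equiv.Perm (Fin 5), (∀ i, i ∉ (S t)ᶜ → τ i = i) → ∀ v : Fin 5 → Fin 5, w t (v ∘ ⇑τ) = w t v))
    (hsupp : ∀ t ∈ T, S t = {0, 1} ∨ S t = {0, 2} ∨ S t = {1, 2}) :
    10 ≤ T.card := by
  classical
  obtain ⟨hu, hw, hid⟩ := hdec
  -- the three shadows and their sum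
  have hsplit : ∀ v : Fin 5 → Fin 5,
      (∑ t ∈ T.filter (fun t => S t = {0, 1}), u t v * w t v) + (∑ t ∈ T.filter (fun t => S t = {0, 2}), u t v * w t v)
        + ∑ t ∈ T.filter (fun t => S t = {1, 2}), u t v * w t v = ∑ t ∈ T, u t v * w t v := by
    intro v
    have h12 : Disjoint (T.filter (fun t => S t = {0, 1})) (T.filter (fun t => S t = {0, 2})) :=
      Finset.disjoint_filter.mpr fun t _ h1 h2 => by rw [h1] at h2; exact absurd h2 (by decide)
    have h3 : Disjoint (T.filter (fun t => S t = {0, 1}) ∪ T.filter (fun t => S t = {0, 2}))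
        (T.filter (fun t => S t = {1, 2})) := by
      rw [Finset.disjoint_union_left]
      exact ⟨Finset.disjoint_filter.mpr fun t _ h1 h2 => by rw [h1] at h2; exact absurd h2 (by decide),
        Finset.disjoint_filter.mpr fun t _ h1 h2 => by rw [h1] at h2; exact absurd h2 (by decide)⟩
    rw [← Finset.sum_union h12, ← Finset.sum_union h3]
    congr 1
    ext t
    simp only [Finset.mem_union, Finset.mem_filter]
    constructor
    · rintro ((⟨ht, -⟩ | ⟨ht, -⟩) | ⟨ht, -⟩) <;> exact ht
    · intro ht
      rcases hsupp t ht with h | h | h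
      · exact Or.inl (Or.inl ⟨ht, h⟩)
      · exact Or.inl (Or.inr ⟨ht, h⟩)
      · exact Or.inr ⟨ht, h⟩
  have hsum : ∀ τ : Equiv.Perm (Fin 5), (∀ i, i ∉ (Finset.univ : Finset (Fin 5)) → τ i = i) →
      ∀ v : Fin 5 → Fin 5,
        ((fun v => ∑ t ∈ T.filter (fun t => S t = {0, 1}), u t v * w t v)
          + (fun v => ∑ t ∈ T.filter (fun t => S t = {0, 2}), u t v * w t v)
          + (fun v => ∑ t ∈ T.filter (fun t => S t = {1, 2}), u t v * w t v)) (v ∘ ⇑τ)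
        = ((fun v => ∑ t ∈ T.filter (fun t => S t = {0, 1}), u t v * w t v)
          + (fun v => ∑ t ∈ T.filter (fun t => S t = {0, 2}), u t v * w t v)
          + (fun v => ∑ t ∈ T.filter (fun t => S t = {1, 2}), u t v * w t v)) v := by
    intro τ _ v
    simp only [Pi.add_apply]
    rw [hsplit, hsplit, hid, hid, if_congr (Equiv.injective_comp τ v) rfl rfl]
  obtain ⟨f01, f02, f12⟩ := threeSplit_separation_triangle _ _ _
    ⟨shadow_inv_left T S u w hw hsym {0, 1}, shadow_inv_right T S u w hu hsym {0, 1}⟩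
    ⟨shadow_inv_left T S u w hw hsym {0, 2}, shadow_inv_right T S u w hu hsym {0, 2}⟩
    ⟨shadow_inv_left T S u w hw hsym {1, 2}, shadow_inv_right T S u w hu hsym {1, 2}⟩ hsum
  refine LaplaceFiveSymmetricPieces.symmetricPieces_needTen N T S u w ⟨hu, hw, hid⟩ ?_ ?_
  · intro t ht
    rcases hsupp t ht with h | h | h <;> rw [h] <;> decide
  · intro A τ hτ v
    by_cases hA : A = {0, 1}
    · subst hA; exact f01 τ hτ v
    by_cases hB : A = {0, 2}
    · subst hB; exact f02 τ hτ v
    by_cases hC : A = {1, 2}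
    · subst hC; exact f12 τ hτ v
    have hempty : T.filter (fun t => S t = A) = ∅ := by
      refine Finset.filter_eq_empty_iff.mpr fun t ht h => ?_
      rcases hsupp t ht with h' | h' | h'
      · exact hA (h ▸ h'.symm ▸ rfl)
      · exact hB (h ▸ h'.symm ▸ rfl)
      · exact hC (h ▸ h'.symm ▸ rfl)
    rw [hempty, Finset.sum_empty, Finset.sum_empty]

end LaplaceFiveTriangleSeparation

end Summit.ValiantsHypothesis.ValiantsHypothesis.Theorems.RigidityForcesSymmetryRankRigidMinimalRepr
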